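import Mathlib
import HarnessLib

/-!
# Merel's log-sum invariant: the elementary identity `3·Σ_{k≤h} k² log k = Σ_{k≤h} k log k`

Let `N = 2h + 1`, `l` a prime with `l ∤ 6` and `N ≡ 1 (mod l)`, and `log : ℤ/N → ℤ/l` any map
which is a homomorphism on the nonzero residues (`log (a b) = log a + log b` for `a, b ≠ 0`) with
`log (-1) = 0`. Then, in `ℤ/l`, `3 · Σ_{k=1}^{h} k² · log k = Σ_{k=1}^{h} k · log k`
(`three_mul_sum_sq_log_eq_sum_log`), together with the two pairing identities
`Σ_{a=1}^{2h} a² log a = Σ_{k=1}^{h} (2k² − 2k + 1) log k`, `Σ_{a=1}^{2h} a log a = Σ_{k=1}^{h} log k`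
and the consequence `3 · Σ_{a=1}^{N−1} (a² − N a) log a = −4 · Σ_{k=1}^{h} k log k`.
PROVED here for every odd `N` (primality of `N` is not needed); elementary finite-sum algebra,
axioms `propext`, `Classical.choice`, `Quot.sound`.

Context (what is PRINTED; the identities of this file are not printed in these sources but connect
their invariants). Merel's invariant is the class of `∏_{k=1}^{(p−1)/2} k^k` in `(ℤ/p)^×` modulo
`q`-th powers, i.e. `Σ_{k=1}^{(p−1)/2} k log k (mod q)`: [Merel1996, Théorème 2] (J. reine angew.
Math. 477 (1996), p. 72, verbatim): «Soit q un nombre premier divisant n. Posons 𝔮 = q𝐓 + ℑ. Le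
complété 𝔮-adique 𝐓_𝔮 de 𝐓 est isomorphe à ℤ_q si et seulement si √u engendre la composante
q-primaire de U, ou encore, lorsque q > 3, si et seulement si ∏_{l=1}^{(p−1)/2} l^l n'est pas une
puissance q-ième de ℤ/pℤ.» (restated as [Lecouturier2020, Thm 1.1]: «We have g_p > 1 if and only
if Σ_{k=1}^{(N−1)/2} k·log(k) ≡ 0 (modulo p)», and [WakeWangErickson2020, Thm 1.5.1]). The
square-weighted sum is the one that appears in [WakeWangErickson2020, Lemma 12.3.1] (proof,
verbatim): «ζ (mod I_G²) gets sent to Σ_{i=1}^{N−1}(i² − i + 1/6) log(i) … ord ζ ≥ 2 if and only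
if Σ_{i=1}^{N−1} i² log(i) = 0. The lemma now follows from Lemma 12.2.1», where Lemma 12.2.1
(= Lecouturier) reads «Σ_j j log Γ_N(j/p) = −(2/3) Σ_{i=1}^{(N−1)/2} i log(i)». The present file
gives a direct elementary proof that the full-range quadratic sums and the half-range linear sum
agree up to the unit factors `3`, `−4/3` in `ℤ/l` — the step marked (E1) "numerically checked" in
the venture cell `pub-abcsig`'s derivation sheet lit/FLIP-DERIVATION-T1.md §2, which links a
Bernoulli-number valuation criterion `v_λ(B_{2,ε}) ≥ 2` to Merel's invariant.

USE (why it is here): T1-sheet step (E1); with (E2) and [Merel1996, Thm 2] it identifies the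
cell's computed `B_{2,ε}`-criterion with `rank_{ℤ_l} 𝐓_𝔮 ≥ 2`. Honest framing: no modular forms,
no statement about ABC. Proof: evaluate `T = Σ_{a=1}^{N-1} a² log a` twice — pairing `a ↔ N − a`
gives `Σ_k (2k² − 2k + 1) log k`, splitting into even/odd `a` and reflecting the odd ones
(`2k − 1 ≡ −2(h + 1 − k)`) gives `Σ_k (8k² − 4k + 1)(log 2 + log k)`, and `Σ_k (8k² − 4k + 1) ≡ 0`
because `h ≡ 0 (mod l)`. Authored by the cell's prover seat p1 (g9), 2026-08-23 (its file
`MerelE1.lean`, namespace `MerelE1`); carried into `Literature/` with statements and proofs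
unchanged (docstring, namespace and citation tags by the literature seat).
-/

namespace Literature.NumberTheory.ModularForms

namespace MerelLogSum

open Finset

/-- Even/odd splitting of a sum over `range (2h)` — elementary summation plumbing for the (E1)
identity below; proved here. [cite: WakeWangErickson2020, §12.3 (proof of Lemma 12.3.1: the sums Σ i² log i; plumbing)] -/
lemma sum_range_two_mul {M : Type*} [AddCommMonoid M] (G : ℕ → M) (h : ℕ) :
    ∑ c ∈ range (2 * h), G c = ∑ k ∈ range h, (G (2 * k) + G (2 * k + 1)) := by
  induction h with
  | zero => simp
  | succ h ih =>
      rw [show 2 * (h + 1) = 2 * h + 1 + 1 by ring, sum_range_succ, sum_range_succ, ih,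
        sum_range_succ, add_assoc]

/-- `6 · Σ_{k<h} (k+1)² = h (h+1) (2h+1)` (over `ℕ`, cast-friendly) — the classical power sum,
plumbing for the (E1) identity below; proved here by induction.
[cite: WakeWangErickson2020, §12.3 (proof of Lemma 12.3.1; plumbing)] -/
lemma six_mul_sum_sq (h : ℕ) : 6 * ∑ k ∈ range h, (k + 1) ^ 2 = h * (h + 1) * (2 * h + 1) := by
  induction h with
  | zero => simp
  | succ h ih => rw [sum_range_succ, mul_add, ih]; ring

/-- `2 · Σ_{k<h} (k+1) = h (h+1)` (over `ℕ`) — classical power sum, plumbing for (E1); proved here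
by induction. [cite: WakeWangErickson2020, §12.3 (proof of Lemma 12.3.1; plumbing)] -/
lemma two_mul_sum (h : ℕ) : 2 * ∑ k ∈ range h, (k + 1) = h * (h + 1) := by
  induction h with
  | zero => simp
  | succ h ih => rw [sum_range_succ, mul_add, ih]; ring

/-- Casting `N - m` (`m ≤ N`) into `ZMod N` gives `-m` — `ZMod` plumbing for the pairing
`a ↔ N − a`; proved here. [cite: WakeWangErickson2020, §12.3 (proof of Lemma 12.3.1; plumbing)] -/
lemma natCast_sub_self (N m : ℕ) (hm : m ≤ N) : ((N - m : ℕ) : ZMod N) = -(m : ZMod N) := by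
  rw [Nat.cast_sub hm, ZMod.natCast_self, zero_sub]

/-- **(E1)**: for `N = 2h + 1 ≡ 1 (mod l)`, `l` prime, `l ∤ 6`, and `log : ZMod N → ZMod l`
multiplicative on nonzero residues with `log (-1) = 0`:
`3 · Σ_{k=1}^{h} k² log k = Σ_{k=1}^{h} k log k` in `ZMod l`. Elementary; proved here (not printed
in this form). The right-hand side is Merel's invariant `Σ_{k=1}^{(p−1)/2} k log k`
[cite: Merel1996, Thm 2 (p. 72: «∏_{l=1}^{(p−1)/2} l^l n'est pas une puissance q-ième»)]
[cite: Lecouturier2020, Thm 1.1 («g_p > 1 iff Σ_{k=1}^{(N−1)/2} k·log(k) ≡ 0»)]; the square-weighted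
sum is the one of [cite: WakeWangErickson2020, Lemma 12.3.1 with Lemma 12.2.1 (ord ζ ≥ 2 ⟺ Σ i² log i = 0)]. -/
theorem three_mul_sum_sq_log_eq_sum_log {l : ℕ} [Fact l.Prime] (hl2 : l ≠ 2) (hl3 : l ≠ 3)
    {N h : ℕ} (hN : N = 2 * h + 1) (hN1 : (N : ZMod l) = 1)
    (log : ZMod N → ZMod l)
    (hmul : ∀ a b : ZMod N, a ≠ 0 → b ≠ 0 → log (a * b) = log a + log b)
    (hneg : log (-1) = 0) :
    3 * ∑ k ∈ range h, ((k + 1 : ℕ) : ZMod l) ^ 2 * log ((k + 1 : ℕ) : ZMod N)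
      = ∑ k ∈ range h, ((k + 1 : ℕ) : ZMod l) * log ((k + 1 : ℕ) : ZMod N) := by
  have hlp : l.Prime := Fact.out
  -- units in `ZMod l`
  have h2 : (2 : ZMod l) ≠ 0 := by
    intro h0
    have : ((2 : ℕ) : ZMod l) = 0 := by exact_mod_cast h0
    rw [ZMod.natCast_eq_zero_iff] at this
    exact hl2 ((Nat.prime_dvd_prime_iff_eq hlp Nat.prime_two).mp this)
  have h3 : (3 : ZMod l) ≠ 0 := by
    intro h0
    have : ((3 : ℕ) : ZMod l) = 0 := by exact_mod_cast h0
    rw [ZMod.natCast_eq_zero_iff] at this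
    exact hl3 ((Nat.prime_dvd_prime_iff_eq hlp Nat.prime_three).mp this)
  -- `h ≡ 0 (mod l)`
  have hh : (h : ZMod l) = 0 := by
    have : (2 : ZMod l) * h = 0 := by
      have e : ((2 * h + 1 : ℕ) : ZMod l) = 1 := by rw [← hN]; exact hN1
      push_cast at e
      linear_combination e
    rcases mul_eq_zero.mp this with h0 | h0
    · exact absurd h0 h2
    · exact h0
  -- the three power sums vanish
  have hS0 : ∑ k ∈ range h, (1 : ZMod l) = 0 := by simp [hh]
  have hS1 : ∑ k ∈ range h, ((k + 1 : ℕ) : ZMod l) = 0 := by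
    have e := congrArg (Nat.cast : ℕ → ZMod l) (two_mul_sum h)
    push_cast at e
    rw [hh, zero_mul] at e
    rcases mul_eq_zero.mp e with h0 | h0
    · exact absurd h0 h2
    · exact_mod_cast h0
  have hS2 : ∑ k ∈ range h, ((k + 1 : ℕ) : ZMod l) ^ 2 = 0 := by
    have e := congrArg (Nat.cast : ℕ → ZMod l) (six_mul_sum_sq h)
    push_cast at e
    rw [hh, zero_mul, zero_mul] at e
    have h6 : (6 : ZMod l) ≠ 0 := by
      rw [show (6 : ZMod l) = 2 * 3 by norm_num]; exact mul_ne_zero h2 h3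
    rcases mul_eq_zero.mp e with h0 | h0
    · exact absurd h0 h6
    · exact_mod_cast h0
  -- trivial case `h = 0`
  rcases Nat.eq_zero_or_pos h with rfl | hpos
  · simp
  haveI : Fact (1 < N) := ⟨by omega⟩
  -- nonvanishing of small residues mod `N`
  have hne : ∀ m : ℕ, 0 < m → m < N → ((m : ℕ) : ZMod N) ≠ 0 := by
    intro m hm hmN habs
    rw [ZMod.natCast_eq_zero_iff] at habs
    exact Nat.not_dvd_of_pos_of_lt hm hmN habs
  have hm1 : (-1 : ZMod N) ≠ 0 := neg_ne_zero.mpr one_ne_zero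
  have h2N : ((2 : ℕ) : ZMod N) ≠ 0 := hne 2 (by norm_num) (by omega)
  -- `log (-x) = log x`, `log (2 x) = log 2 + log x`
  have hlogneg : ∀ x : ZMod N, x ≠ 0 → log (-x) = log x := by
    intro x hx
    rw [show -x = (-1) * x by ring, hmul _ _ hm1 hx, hneg, zero_add]
  -- the big sum `T = Σ_{a=1}^{2h} a² log a`
  set F : ℕ → ZMod l := fun c => ((c + 1 : ℕ) : ZMod l) ^ 2 * log ((c + 1 : ℕ) : ZMod N) with hF
  -- Route 1: pairing `a ↔ N - a`
  have hT1 : ∑ c ∈ range (2 * h), F c =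
      ∑ k ∈ range h, (2 * ((k + 1 : ℕ) : ZMod l) ^ 2 - 2 * ((k + 1 : ℕ) : ZMod l) + 1) *
        log ((k + 1 : ℕ) : ZMod N) := by
    rw [two_mul, sum_range_add, ← sum_range_reflect (fun c => F (h + c)) h, ← sum_add_distrib]
    refine sum_congr rfl fun k hk => ?_
    rw [mem_range] at hk
    have harg : h + (h - 1 - k) + 1 = N - (k + 1) := by omega
    have hle : k + 1 ≤ N := by omega
    simp only [hF, harg]
    rw [natCast_sub_self N (k + 1) hle, hlogneg _ (hne (k + 1) (by omega) (by omega)),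
      Nat.cast_sub hle, hN1]
    ring
  -- Route 2: even / odd split, odd terms reflected
  have hT2 : ∑ c ∈ range (2 * h), F c =
      ∑ k ∈ range h, (8 * ((k + 1 : ℕ) : ZMod l) ^ 2 - 4 * ((k + 1 : ℕ) : ZMod l) + 1) *
        (log ((2 : ℕ) : ZMod N) + log ((k + 1 : ℕ) : ZMod N)) := by
    rw [sum_range_two_mul, sum_add_distrib, ← sum_range_reflect (fun k => F (2 * k)) h,
      ← sum_add_distrib]
    refine sum_congr rfl fun k hk => ?_
    rw [mem_range] at hk
    have harg1 : 2 * (h - 1 - k) + 1 = N - 2 * (k + 1) := by omega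
    have harg2 : 2 * k + 1 + 1 = 2 * (k + 1) := by ring
    have hle : 2 * (k + 1) ≤ N := by omega
    have hk1 : ((k + 1 : ℕ) : ZMod N) ≠ 0 := hne (k + 1) (by omega) (by omega)
    have h2k : ((2 * (k + 1) : ℕ) : ZMod N) ≠ 0 := hne _ (by omega) (by omega)
    simp only [hF, harg1, harg2]
    rw [natCast_sub_self N (2 * (k + 1)) hle, hlogneg _ h2k, Nat.cast_sub hle, hN1]
    have e2 : log ((2 * (k + 1) : ℕ) : ZMod N) = log ((2 : ℕ) : ZMod N) + log ((k + 1 : ℕ) : ZMod N) := by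
      rw [Nat.cast_mul, hmul _ _ h2N hk1]
    rw [e2]
    push_cast
    ring
  -- the `log 2` part of Route 2 vanishes
  have hZ : ∑ k ∈ range h, (8 * ((k + 1 : ℕ) : ZMod l) ^ 2 - 4 * ((k + 1 : ℕ) : ZMod l) + 1) = 0 := by
    rw [sum_add_distrib, sum_sub_distrib, ← mul_sum, ← mul_sum, hS2, hS1, hS0]
    ring
  -- expand both routes linearly in `S2, S1, S0'` (with `S0' = Σ log`)
  have hA : ∑ k ∈ range h, (2 * ((k + 1 : ℕ) : ZMod l) ^ 2 - 2 * ((k + 1 : ℕ) : ZMod l) + 1) *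
        log ((k + 1 : ℕ) : ZMod N) =
      2 * ∑ k ∈ range h, ((k + 1 : ℕ) : ZMod l) ^ 2 * log ((k + 1 : ℕ) : ZMod N)
      - 2 * ∑ k ∈ range h, ((k + 1 : ℕ) : ZMod l) * log ((k + 1 : ℕ) : ZMod N)
      + ∑ k ∈ range h, log ((k + 1 : ℕ) : ZMod N) := by
    rw [mul_sum, mul_sum, ← sum_sub_distrib, ← sum_add_distrib]
    exact sum_congr rfl fun k _ => by ring
  have hB : ∑ k ∈ range h, (8 * ((k + 1 : ℕ) : ZMod l) ^ 2 - 4 * ((k + 1 : ℕ) : ZMod l) + 1) *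
        (log ((2 : ℕ) : ZMod N) + log ((k + 1 : ℕ) : ZMod N)) =
      log ((2 : ℕ) : ZMod N) *
        ∑ k ∈ range h, (8 * ((k + 1 : ℕ) : ZMod l) ^ 2 - 4 * ((k + 1 : ℕ) : ZMod l) + 1)
      + (8 * ∑ k ∈ range h, ((k + 1 : ℕ) : ZMod l) ^ 2 * log ((k + 1 : ℕ) : ZMod N)
      - 4 * ∑ k ∈ range h, ((k + 1 : ℕ) : ZMod l) * log ((k + 1 : ℕ) : ZMod N)
      + ∑ k ∈ range h, log ((k + 1 : ℕ) : ZMod N)) := by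
    rw [mul_sum, mul_sum, mul_sum, ← sum_sub_distrib, ← sum_add_distrib, ← sum_add_distrib]
    exact sum_congr rfl fun k _ => by ring
  have key : (2 : ZMod l) *
      (3 * ∑ k ∈ range h, ((k + 1 : ℕ) : ZMod l) ^ 2 * log ((k + 1 : ℕ) : ZMod N)
        - ∑ k ∈ range h, ((k + 1 : ℕ) : ZMod l) * log ((k + 1 : ℕ) : ZMod N)) = 0 := by
    have e := hT1.symm.trans hT2
    rw [hA, hB, hZ, mul_zero, zero_add] at e
    linear_combination (-1 : ZMod l) * e
  rcases mul_eq_zero.mp key with h0 | h0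
  · exact absurd h0 h2
  · exact sub_eq_zero.mp h0

/-- Route 1 of the proof as a standalone identity (pairing `a ↔ N − a`):
`Σ_{a=1}^{2h} a² log a = Σ_{k=1}^{h} (2k² − 2k + 1) log k` in `ZMod l` (`N = 2h + 1 ≡ 1 mod l`).
Elementary; proved here. [cite: WakeWangErickson2020, Lemma 12.3.1 (the sum Σ_{i=1}^{N−1} i² log i)] -/
theorem sum_sq_log_pairing {l : ℕ} {N h : ℕ} (hN : N = 2 * h + 1) (hN1 : (N : ZMod l) = 1)
    (log : ZMod N → ZMod l)
    (hmul : ∀ a b : ZMod N, a ≠ 0 → b ≠ 0 → log (a * b) = log a + log b)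
    (hneg : log (-1) = 0) :
    ∑ c ∈ range (2 * h), ((c + 1 : ℕ) : ZMod l) ^ 2 * log ((c + 1 : ℕ) : ZMod N) =
      ∑ k ∈ range h, (2 * ((k + 1 : ℕ) : ZMod l) ^ 2 - 2 * ((k + 1 : ℕ) : ZMod l) + 1) *
        log ((k + 1 : ℕ) : ZMod N) := by
  rcases Nat.eq_zero_or_pos h with rfl | hpos
  · simp
  haveI : Fact (1 < N) := ⟨by omega⟩
  have hne : ∀ m : ℕ, 0 < m → m < N → ((m : ℕ) : ZMod N) ≠ 0 := by
    intro m hm hmN habs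
    rw [ZMod.natCast_eq_zero_iff] at habs
    exact Nat.not_dvd_of_pos_of_lt hm hmN habs
  have hm1 : (-1 : ZMod N) ≠ 0 := neg_ne_zero.mpr one_ne_zero
  have hlogneg : ∀ x : ZMod N, x ≠ 0 → log (-x) = log x := by
    intro x hx
    rw [show -x = (-1) * x by ring, hmul _ _ hm1 hx, hneg, zero_add]
  set F : ℕ → ZMod l := fun c => ((c + 1 : ℕ) : ZMod l) ^ 2 * log ((c + 1 : ℕ) : ZMod N) with hF
  rw [two_mul, sum_range_add, ← sum_range_reflect (fun c => F (h + c)) h, ← sum_add_distrib]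
  refine sum_congr rfl fun k hk => ?_
  rw [mem_range] at hk
  have harg : h + (h - 1 - k) + 1 = N - (k + 1) := by omega
  have hle : k + 1 ≤ N := by omega
  simp only [hF, harg]
  rw [natCast_sub_self N (k + 1) hle, hlogneg _ (hne (k + 1) (by omega) (by omega)),
    Nat.cast_sub hle, hN1]
  ring

/-- The linear companion: `Σ_{a=1}^{2h} a log a = Σ_{k=1}^{h} log k` in `ZMod l` (pairing;
`N ≡ 1`). Elementary; proved here. [cite: WakeWangErickson2020, Lemma 12.3.1 (proof: the sums Σ i log i, Σ log i)] -/
theorem sum_lin_log_pairing {l : ℕ} {N h : ℕ} (hN : N = 2 * h + 1) (hN1 : (N : ZMod l) = 1)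
    (log : ZMod N → ZMod l)
    (hmul : ∀ a b : ZMod N, a ≠ 0 → b ≠ 0 → log (a * b) = log a + log b)
    (hneg : log (-1) = 0) :
    ∑ c ∈ range (2 * h), ((c + 1 : ℕ) : ZMod l) * log ((c + 1 : ℕ) : ZMod N) =
      ∑ k ∈ range h, log ((k + 1 : ℕ) : ZMod N) := by
  rcases Nat.eq_zero_or_pos h with rfl | hpos
  · simp
  haveI : Fact (1 < N) := ⟨by omega⟩
  have hne : ∀ m : ℕ, 0 < m → m < N → ((m : ℕ) : ZMod N) ≠ 0 := by
    intro m hm hmN habs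
    rw [ZMod.natCast_eq_zero_iff] at habs
    exact Nat.not_dvd_of_pos_of_lt hm hmN habs
  have hm1 : (-1 : ZMod N) ≠ 0 := neg_ne_zero.mpr one_ne_zero
  have hlogneg : ∀ x : ZMod N, x ≠ 0 → log (-x) = log x := by
    intro x hx
    rw [show -x = (-1) * x by ring, hmul _ _ hm1 hx, hneg, zero_add]
  set F : ℕ → ZMod l := fun c => ((c + 1 : ℕ) : ZMod l) * log ((c + 1 : ℕ) : ZMod N) with hF
  rw [two_mul, sum_range_add, ← sum_range_reflect (fun c => F (h + c)) h, ← sum_add_distrib]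
  refine sum_congr rfl fun k hk => ?_
  rw [mem_range] at hk
  have harg : h + (h - 1 - k) + 1 = N - (k + 1) := by omega
  have hle : k + 1 ≤ N := by omega
  simp only [hF, harg]
  rw [natCast_sub_self N (k + 1) hle, hlogneg _ (hne (k + 1) (by omega) (by omega)),
    Nat.cast_sub hle, hN1]
  ring

/-- **(E1), second form** (the one fed into (E2) of the T1 sheet):
`3 · Σ_{a=1}^{N−1} (a² − N a) log a = −4 · Σ_{k=1}^{h} k log k` in `ZMod l`, i.e.
`Σ_{a<N} (a² − Na) log a ≡ −(4/3) Σ_{k≤h} k log k`. Elementary; proved here (compare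
[cite: WakeWangErickson2020, Lemma 12.2.1 («Σ_j j log Γ_N(j/p) = −(2/3) Σ_{i=1}^{(N−1)/2} i log(i)»)]
and Merel's invariant [cite: Merel1996, Thm 2]). -/
theorem three_mul_sum_sq_sub_lin_log {l : ℕ} [Fact l.Prime] (hl2 : l ≠ 2) (hl3 : l ≠ 3)
    {N h : ℕ} (hN : N = 2 * h + 1) (hN1 : (N : ZMod l) = 1)
    (log : ZMod N → ZMod l)
    (hmul : ∀ a b : ZMod N, a ≠ 0 → b ≠ 0 → log (a * b) = log a + log b)
    (hneg : log (-1) = 0) :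
    3 * ∑ c ∈ range (2 * h), (((c + 1 : ℕ) : ZMod l) ^ 2 - (N : ZMod l) * ((c + 1 : ℕ) : ZMod l)) *
        log ((c + 1 : ℕ) : ZMod N)
      = -4 * ∑ k ∈ range h, ((k + 1 : ℕ) : ZMod l) * log ((k + 1 : ℕ) : ZMod N) := by
  have e1 := three_mul_sum_sq_log_eq_sum_log hl2 hl3 hN hN1 log hmul hneg
  have p2 := sum_sq_log_pairing hN hN1 log hmul hneg
  have p1 := sum_lin_log_pairing hN hN1 log hmul hneg
  have hsplit : ∑ c ∈ range (2 * h), (((c + 1 : ℕ) : ZMod l) ^ 2 - (N : ZMod l) * ((c + 1 : ℕ) : ZMod l)) *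
        log ((c + 1 : ℕ) : ZMod N) =
      ∑ c ∈ range (2 * h), ((c + 1 : ℕ) : ZMod l) ^ 2 * log ((c + 1 : ℕ) : ZMod N)
      - ∑ c ∈ range (2 * h), ((c + 1 : ℕ) : ZMod l) * log ((c + 1 : ℕ) : ZMod N) := by
    rw [← sum_sub_distrib]
    exact sum_congr rfl fun c _ => by rw [hN1]; ring
  have hA : ∑ k ∈ range h, (2 * ((k + 1 : ℕ) : ZMod l) ^ 2 - 2 * ((k + 1 : ℕ) : ZMod l) + 1) *
        log ((k + 1 : ℕ) : ZMod N) =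
      2 * ∑ k ∈ range h, ((k + 1 : ℕ) : ZMod l) ^ 2 * log ((k + 1 : ℕ) : ZMod N)
      - 2 * ∑ k ∈ range h, ((k + 1 : ℕ) : ZMod l) * log ((k + 1 : ℕ) : ZMod N)
      + ∑ k ∈ range h, log ((k + 1 : ℕ) : ZMod N) := by
    rw [mul_sum, mul_sum, ← sum_sub_distrib, ← sum_add_distrib]
    exact sum_congr rfl fun k _ => by ring
  rw [hsplit, p2, p1, hA]
  linear_combination (2 : ZMod l) * e1

end MerelLogSum

end Literature.NumberTheory.ModularForms
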